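import Summits.BirchSwinnertonDyer.BirchSwinnertonDyer.Theses.LeadingTerm
import Summits.BirchSwinnertonDyer.BirchSwinnertonDyer.Theses.Squeeze
import Summits.BirchSwinnertonDyer.BirchSwinnertonDyer.Theorems.LeadingTermSqueezeUBR2ThreeCells
import Literature.NumberTheory.EllipticCurves.SelmerCorankHolds
import Literature.NumberTheory.EllipticCurves.BSDConductor
import HarnessLib

/-!
# Strategist p1 — typed artefacts of STRATEGY-CENSUS v3 (crux stmt-BirchSwinnertonDyer-0145)

Every signature quoted in the census's NEW attempts that the tree can type, with the glue that is
claimed "proved" there. Nothing here is a line or an item; `lean check` rc 0, 0 sorries.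

* §Strengthen S6 `PConverseLadder` (p-converse at one prime, all levels) and `squeezeUBR2_of_pConverseLadder`.
* §Strengthen S8 `GapAtTwo` — typed only to record that, as a bare `∃ ε`, it is contentless (its content
  is effectivity, which a `Prop` cannot carry); no proof is offered or needed.
* §Decomposition D6 `UBE4CM` / `UBE4NonCM` with `ube4_of_cm_split`, D7 `NoExcessAtTwo` / `UBE4FromThree`
  with `ube4_of_two_and_fromThree`; D8's children and glue are in `LeadingTermSqueezeUBR2Split.lean`.
-/

set_option linter.dupNamespace false

namespace Summit.BirchSwinnertonDyer.BirchSwinnertonDyer.Cruxes.SqueezeUB.StrategistP1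

open WeierstrassCurve Literature.NumberTheory.EllipticCurves
open Summit.BirchSwinnertonDyer.BirchSwinnertonDyer.Theses.Squeeze (SqueezeUB SqueezeParity)
open Summit.BirchSwinnertonDyer.BirchSwinnertonDyer.Theses.LeadingTerm (SqueezeUBR2)
open Summit.BirchSwinnertonDyer.BirchSwinnertonDyer.Theorems

/-! ### The open leaf UBE4 (child 3 of D8), as a local abbreviation -/

/-- UBE4, the parity-blind core (= registered stub `stub_squeezeUB_of_parity_match`, = child 3 of D8). -/
def UBE4 : Prop :=
  ∀ (W : WeierstrassCurve ℚ) [W.IsElliptic] [W.IsGloballyMinimal],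
    4 ≤ W.mordellWeilRank → 2 ≤ W.analyticRank →
      W.mordellWeilRank % 2 = W.analyticRank % 2 → W.mordellWeilRank ≤ W.analyticRank

/-! ### S6 — p-converse ladder at one prime -/

/-- S6: for every elliptic `E/ℚ` there is ONE prime `p` at which the `p`-converse holds at every level:
`corank Sel_{p^∞}(E/ℚ) = r ⇒ r_an(E) = r`. Its UB-half is the one-prime Selmer cap (S2). -/
def PConverseLadder : Prop :=
  ∀ (W : WeierstrassCurve ℚ) [W.IsElliptic], ∃ p : ℕ, p.Prime ∧
    ∀ r : ℕ, W.selmerCorank p = r → W.analyticRank = r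

/-- S6 ⇒ the crux, with NO Ш-finiteness: `r_an = corank_p ≥ rank` by Kummer theory
(`selmerCorank = rank + shaCorank`, tree theorem `selmerCorank_eq_mordellWeilRank_add_holds`). [folklore] -/
theorem squeezeUBR2_of_pConverseLadder (h : PConverseLadder) : SqueezeUBR2 := by
  intro W _
  obtain ⟨p, hp, hlad⟩ := h W
  haveI : Fact p.Prime := ⟨hp⟩
  have hcor : W.analyticRank = W.selmerCorank p := hlad (W.selmerCorank p) rfl
  have hadd : W.selmerCorank p = W.mordellWeilRank + W.shaCorank p :=
    W.selmerCorank_eq_mordellWeilRank_add_holds p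
  omega

/-! ### S8 — the bare gap statement (contentless as a Prop; recorded, not used) -/

/-- S8 as a bare existence statement: SOME positive function of the conductor separates `L''(E,1) ≠ 0`
from `0` among curves with `L(E,1) = 0`. TRUE and EMPTY (finitely many curves per conductor), hence
never a stub: the census's S8 is about an EXPLICIT `ε`, which a `Prop` cannot express. -/
def GapAtTwo : Prop :=
  ∃ ε : ℕ → ℝ, (∀ n, 0 < ε n) ∧
    ∀ (W : WeierstrassCurve ℚ) [W.IsElliptic] [W.IsGloballyMinimal],
      W.entireLFunction 1 = 0 →
        ‖iteratedDeriv 2 W.entireLFunction 1‖ < ε (W.conductorNorm ℤ) →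
          iteratedDeriv 2 W.entireLFunction 1 = 0

/-! ### D6 — CM / non-CM cut of UBE4 -/

/-- UBE4 on CM curves. -/
def UBE4CM : Prop :=
  ∀ (W : WeierstrassCurve ℚ) [W.IsElliptic] [W.IsGloballyMinimal], W.HasCM →
    4 ≤ W.mordellWeilRank → 2 ≤ W.analyticRank →
      W.mordellWeilRank % 2 = W.analyticRank % 2 → W.mordellWeilRank ≤ W.analyticRank

/-- UBE4 on non-CM curves. -/
def UBE4NonCM : Prop :=
  ∀ (W : WeierstrassCurve ℚ) [W.IsElliptic] [W.IsGloballyMinimal], ¬ W.HasCM →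
    4 ≤ W.mordellWeilRank → 2 ≤ W.analyticRank →
      W.mordellWeilRank % 2 = W.analyticRank % 2 → W.mordellWeilRank ≤ W.analyticRank

/-- D6 glue (trivial case split; recorded, NOT filed — neither piece has a plan). [folklore] -/
theorem ube4_of_cm_split (hCM : UBE4CM) (hN : UBE4NonCM) : UBE4 := by
  intro W _ _ h4 h2 hp
  by_cases hc : W.HasCM
  · exact hCM W hc h4 h2 hp
  · exact hN W hc h4 h2 hp

/-- D6 converse: both pieces are restrictions of UBE4 (the cut is exact). [folklore] -/
theorem cm_split_of_ube4 (h : UBE4) : UBE4CM ∧ UBE4NonCM :=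
  ⟨fun W _ _ _ => h W, fun W _ _ _ => h W⟩

/-! ### D7 — first cell / rest -/

/-- The first open cell NoExcessAt 2 in UBE4's binders: four points and matching parity force `r_an ≠ 2`. -/
def NoExcessAtTwo : Prop :=
  ∀ (W : WeierstrassCurve ℚ) [W.IsElliptic] [W.IsGloballyMinimal],
    4 ≤ W.mordellWeilRank → W.mordellWeilRank % 2 = W.analyticRank % 2 → W.analyticRank ≠ 2

/-- UBE4 above analytic rank 3. -/
def UBE4FromThree : Prop :=
  ∀ (W : WeierstrassCurve ℚ) [W.IsElliptic] [W.IsGloballyMinimal],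
    4 ≤ W.mordellWeilRank → 3 ≤ W.analyticRank →
      W.mordellWeilRank % 2 = W.analyticRank % 2 → W.mordellWeilRank ≤ W.analyticRank

/-- D7 glue: UBE4 ⇐ NoExcessAt 2 ∧ UBE4_{r_an ≥ 3} (recorded, NOT filed). [folklore] -/
theorem ube4_of_two_and_fromThree (h2 : NoExcessAtTwo) (h3 : UBE4FromThree) : UBE4 := by
  intro W _ _ h4 h2le hp
  have hne : W.analyticRank ≠ 2 := h2 W h4 hp
  exact h3 W h4 (by omega) hp

/-- D7 converse (the cut is exact). [folklore] -/
theorem two_and_fromThree_of_ube4 (h : UBE4) : NoExcessAtTwo ∧ UBE4FromThree := by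
  refine ⟨fun W _ _ h4 hp h2 => ?_, fun W _ _ h4 h3 hp => h W h4 (by omega) hp⟩
  have := h W h4 (by omega) hp
  omega

/-! ### D8 — the filed decomposition, restated: crux ⇐ ParityMW ∧ GZKCell ∧ UBE4 (landed p132393) -/

/-- D8 glue in the `--glue-by` order (parity, GZK, UBE4), concluding the crux by name. [folklore] -/
theorem squeezeUBR2_of_parity_gzk_ube4 (hPar : SqueezeParity)
    (hGZK : ∀ (W : WeierstrassCurve ℚ) [W.IsElliptic] [W.IsGloballyMinimal],
      W.analyticRank ≤ 1 → W.mordellWeilRank ≤ W.analyticRank)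
    (hUBE : UBE4) : SqueezeUBR2 :=
  squeezeUB_of_squeezeParity_of_gzk_of_ube4 hPar hGZK hUBE

end Summit.BirchSwinnertonDyer.BirchSwinnertonDyer.Cruxes.SqueezeUB.StrategistP1
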